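import Summits.QuantumAdvantage.QuantumAdvantage.Theorems.CubicForrelationNearExactIsExactTwoModSixSecondStructure
import Summits.QuantumAdvantage.QuantumAdvantage.Theorems.CubicForrelationNearExactIsExactFourteenSecondStructureB
import Summits.QuantumAdvantage.QuantumAdvantage.Theorems.CubicForrelationNearExactIsExactTwoModSixSecondCheapRank

/-!
# Crux `CubicForrelation.NearExactIsExact` (stmt-QuantumAdvantage-14043) — the SECOND boundary on the residue class `n ≡ 2 (mod 6)`:
  uniform packaging at the literal type `Fin n` (`n ≥ 14`)

Certificate seat `b2b-cforr-cert` (gen 9).  HONEST FRAMING: for `n ≡ 0, 4 (mod 6)`, `n ≥ 12`, the tree proves `Φ ≥ 1 − 2^{−⌊n/3⌋} ⇒ Φ = 1`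
(`isolation_closed_second_boundary`); for `n ≡ 2 (mod 6)` that implication is OPEN.  This file states, uniformly in `n = 6r+2 ≥ 14`, what
the tree DOES certify there: the high Walsh levels are exact (`isolation_two_mod_six_high_levels`: `W_g ∈ 2^{⌊n/3⌋+3}ℤ ⇒ Φ = 1`) and a
hypothetical pair with `1 − 2^{−⌊n/3⌋} ≤ Φ < 1` lies in an explicit residual list (`second_boundary_structure_two_mod_six`; per side and
independently of the other side: `second_boundary_side_two_mod_six`, `tm2_side_structure`, `fo_side_structure`): a side at level
`⌊n/3⌋+2` with an odd set of size in `[2^{n−2}, 2^{n−1})`, or two type-O sides (`W = 2^{⌊n/3⌋+1}u`, `u` odd) each with first-digit radical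
`< 2^{n−2}` (rank `≥ 4`) or with radical `≥ 2^{n−2}` and every point cheap, `u ≡ 2^{n/6} ± 1 (mod 8)` (at `n = 14` this reads `d₁ ≠ d₂`,
case A; for `n ≥ 20`, `d₁ = d₂`; cheapness forces rank `≤ 2`, `tm2_cheap_rank_le_two`).
Assembled from `second_boundary_structure_fourteen_sharp` / `fo_levelSeven_exact` (`n = 14`) and `tm2_second_structure` / `tm2_levels_exact`
(`n ≥ 20`).  Infinitely many finite-slice statements; NOT a proof of `θ_n < 1 − 2^{−⌊n/3⌋}`, NOT summit progress.

References: as in the imported files.  Everything below is proved from the tree; axioms are the standard three.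
-/

set_option linter.dupNamespace false -- D-0017: single-problem summit ⇒ `QuantumAdvantage.QuantumAdvantage` by design

noncomputable section

namespace Summit.QuantumAdvantage.QuantumAdvantage.Theorems.CubicForrelation.NearExactIsExact

open Finset
open Literature.Computability.QuantumComplexity
open Literature.Computability.QuantumComplexity.BuzetChailloux (bxor zeroVec)
open Literature.Computability.QuantumComplexity.DerivativeWalsh (W)

/-- The cheap digit class for `r ≥ 3`: for odd `m`, `[⌊m/2⌋ odd] = [⌊m/4⌋ odd]` iff `m ≡ 2^r ± 1 (mod 8)` (i.e. `m ≡ ±1`). [elementary] -/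
theorem tm2_cheap_iff (r : ℕ) (hr : 3 ≤ r) (m : ℤ) (hm : Odd m) :
    (Odd (m / 2) ↔ Odd (m / 2 / 2)) ↔ ((8 : ℤ) ∣ m - 2 ^ r - 1 ∨ (8 : ℤ) ∣ m - 2 ^ r + 1) := by
  obtain ⟨k, rfl⟩ : ∃ k, r = k + 3 := ⟨r - 3, by omega⟩
  have h8 : (2 : ℤ) ^ (k + 3) = 8 * 2 ^ k := by ring
  rw [h8]
  obtain ⟨a, rfl⟩ := hm
  simp only [Int.odd_iff]
  omega

/-- The cheap digit class at `r = 2` (`n = 14`): for odd `m`, `[⌊m/2⌋ odd] ≠ [⌊m/4⌋ odd]` iff `m ≡ 4 ± 1 (mod 8)`. [elementary] -/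
theorem fo_cheap_iff (m : ℤ) (hm : Odd m) :
    ¬ (Odd (m / 2) ↔ Odd (m / 2 / 2)) ↔ ((8 : ℤ) ∣ m - 2 ^ 2 - 1 ∨ (8 : ℤ) ∣ m - 2 ^ 2 + 1) := by
  obtain ⟨a, rfl⟩ := hm
  simp only [Int.odd_iff]
  omega

/-- **High levels are exact on `n ≡ 2 (mod 6)`, `n ≥ 14`.** For cubic `f, g : 𝔽₂ⁿ → 𝔽₂` with `W_g ∈ 2^{⌊n/3⌋+3}ℤ` and
`Φ(f,g) ≥ 1 − 2^{−⌊n/3⌋}`: `Φ(f,g) = 1` (`fo_levelSeven_exact` at `n = 14`, `tm2_levels_exact` for `n ≥ 20`).  Infinitely many finite-slice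
verdicts; NOT summit progress. [this work] -/
theorem isolation_two_mod_six_high_levels : ∀ n : ℕ, n % 6 = 2 → 14 ≤ n → ∀ f g : (Fin n → Bool) → Bool,
    IsDegLeFun 3 f → IsDegLeFun 3 g → ∀ w : (Fin n → Bool) → ℤ, (∀ x, W (fun y => signOf (g y)) x = (2 : ℝ) ^ (n / 3 + 3) * (w x : ℝ)) →
    1 - (1 / 2 : ℝ) ^ (n / 3) ≤ forrelation f g → forrelation f g = 1 := by
  intro n hn h14 f g hf hg w hw hΦ
  obtain ⟨r, rfl⟩ : ∃ r, n = (3 * r + 1) + (3 * r + 1) := ⟨n / 6, by omega⟩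
  have e1 : ((3 * r + 1) + (3 * r + 1)) / 3 = 2 * r := by omega
  rw [e1] at hΦ hw
  have hr2 : 2 ≤ r := by omega
  rcases Nat.eq_or_lt_of_le hr2 with rfl | hr3
  · exact fo_levelSeven_exact f g hf hg w hw (by norm_num at hΦ; exact hΦ)
  · exact tm2_levels_exact r hr3 f g hf hg w hw hΦ

/-- **Per-side structure (`r ≥ 3`).**  For cubic `f, g` on `6r+2` bits with `1 − (1/2)^{2r} ≤ Φ(f,g) ≠ 1`, the `g`-side is EITHER at level
`2r+2` with `2^{6r} ≤ #{W_g/2^{2r+2} odd} < 2^{6r+1}` OR of type O (`W_g = 2^{2r+1}u`, `u` odd everywhere) with first-digit radical `< 2^{6r}` or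
`d₁ = d₂` everywhere — independently of the `f`-side (apply to `(g,f)` for the other side).  NOT summit progress. [this work] -/
theorem tm2_side_structure (r : ℕ) (hr : 3 ≤ r) (f g : (Fin ((3 * r + 1) + (3 * r + 1)) → Bool) → Bool) (hf : IsDegLeFun 3 f)
    (hg : IsDegLeFun 3 g) (hΦ : 1 - (1 / 2 : ℝ) ^ (2 * r) ≤ forrelation f g) (hne : forrelation f g ≠ 1) :
    (∃ u' : (Fin ((3 * r + 1) + (3 * r + 1)) → Bool) → ℤ, (∀ x, W (fun y => signOf (g y)) x = (2 : ℝ) ^ (2 * r + 2) * (u' x : ℝ)) ∧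
      2 ^ (6 * r) ≤ #(univ.filter fun x : Fin ((3 * r + 1) + (3 * r + 1)) → Bool => Odd (u' x)) ∧
      #(univ.filter fun x : Fin ((3 * r + 1) + (3 * r + 1)) → Bool => Odd (u' x)) < 2 ^ (6 * r + 1)) ∨
    (∃ u : (Fin ((3 * r + 1) + (3 * r + 1)) → Bool) → ℤ, (∀ x, W (fun y => signOf (g y)) x = (2 : ℝ) ^ (2 * r + 1) * (u x : ℝ)) ∧
      (∀ x, Odd (u x)) ∧
      (#(univ.filter fun a : Fin ((3 * r + 1) + (3 * r + 1)) → Bool => ∀ b, (decide (Odd (u zeroVec / 2)) ^^ decide (Odd (u a / 2)) ^^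
          decide (Odd (u b / 2)) ^^ decide (Odd (u (bxor a b) / 2))) = false) < 2 ^ (6 * r) ∨
        ∀ x, (Odd (u x / 2) ↔ Odd (u x / 2 / 2)))) := by
  classical
  obtain ⟨u, hu⟩ := tw_base g hg (2 * r + 1) (by omega)
  by_cases hog : ∀ x, Odd (u x)
  · refine Or.inr ⟨u, hu, hog, ?_⟩
    by_contra h
    rw [not_or, not_lt, not_forall] at h
    exact tm2_lowrank_false r hr f g hg u hu hog h.1 h.2 hΦ
  · push Not at hog
    obtain ⟨x₀, hx₀⟩ := hog
    have hev : ∀ x, ¬ Odd (u x) := fun x h => hx₀ ((tm2_parity_const r g u hg hu x x₀).1 h)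
    have hu6 := tw_level_up g u hu hev
    by_cases h6 : ∃ x, Odd (u x / 2)
    · exact Or.inl ⟨fun x => u x / 2, hu6, tm2_levelTwo_card r (by omega) f g hf hg _ hu6 h6 hΦ⟩
    · push Not at h6
      have hu7 := tw_level_up g (fun x => u x / 2) hu6 h6
      exact absurd (tm2_levels_exact r hr f g hf hg _ hu7 hΦ) hne

/-- **Per-side structure at `n = 14`** (`r = 2`; there the cheap class is `d₁ ≠ d₂`, case A).  NOT summit progress. [this work] -/
theorem fo_side_structure (f g : (Fin (7 + 7) → Bool) → Bool) (hf : IsDegLeFun 3 f) (hg : IsDegLeFun 3 g)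
    (hΦ : (15 / 16 : ℝ) ≤ forrelation f g) (hne : forrelation f g ≠ 1) :
    (∃ u' : (Fin (7 + 7) → Bool) → ℤ, (∀ x, W (fun y => signOf (g y)) x = (2 : ℝ) ^ 6 * (u' x : ℝ)) ∧
      4096 ≤ #(univ.filter fun x : Fin (7 + 7) → Bool => Odd (u' x)) ∧
      #(univ.filter fun x : Fin (7 + 7) → Bool => Odd (u' x)) < 8192) ∨
    (∃ u : (Fin (7 + 7) → Bool) → ℤ, (∀ x, W (fun y => signOf (g y)) x = (2 : ℝ) ^ 5 * (u x : ℝ)) ∧ (∀ x, Odd (u x)) ∧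
      (#(univ.filter fun a : Fin (7 + 7) → Bool => ∀ b, (decide (Odd (u zeroVec / 2)) ^^ decide (Odd (u a / 2)) ^^
          decide (Odd (u b / 2)) ^^ decide (Odd (u (bxor a b) / 2))) = false) < 2 ^ 12 ∨
        ∀ x, ¬ (Odd (u x / 2) ↔ Odd (u x / 2 / 2)))) := by
  classical
  obtain ⟨u, hu⟩ := tw_base g hg 5 (by norm_num)
  by_cases hog : ∀ x, Odd (u x)
  · refine Or.inr ⟨u, hu, hog, ?_⟩
    by_contra h
    rw [not_or, not_lt, not_forall] at h
    obtain ⟨hR, x, hx⟩ := h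
    exact fo_lowrank_false f g hg u hu hog hR ⟨x, not_not.1 hx⟩ hΦ
  · push Not at hog
    obtain ⟨x₀, hx₀⟩ := hog
    have hev : ∀ x, ¬ Odd (u x) := fun x h => hx₀ ((fd_parity_const g u hg hu x x₀).1 h)
    have hu6 := tw_level_up g u hu hev
    by_cases h6 : ∃ x, Odd (u x / 2)
    · exact Or.inl ⟨fun x => u x / 2, hu6, fo_levelSix_card f g hf hg _ hu6 h6 hΦ⟩
    · push Not at h6
      have hu7 := tw_level_up g (fun x => u x / 2) hu6 h6
      exact absurd (fo_levelSeven_exact f g hf hg _ hu7 hΦ) hne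

/-- **Per-side structure, uniformly on `n ≡ 2 (mod 6)`, `n ≥ 14`.**  If cubic `f, g : 𝔽₂ⁿ → 𝔽₂` satisfy `1 − 2^{−⌊n/3⌋} ≤ Φ(f,g) ≠ 1` then
the `g`-side is at level `⌊n/3⌋+2` with an odd set of size in `[2^{n−2}, 2^{n−1})`, or of type O with first-digit radical `< 2^{n−2}` (rank
`≥ 4`), or of type O with radical `≥ 2^{n−2}` (rank `≤ 2`) and every point cheap (`u ≡ 2^{n/6} ± 1 (mod 8)`); by the symmetry of `Φ` the same
holds for the `f`-side.  NOT a proof of `θ_n < 1 − 2^{−⌊n/3⌋}`, NOT summit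
progress. [this work] -/
theorem second_boundary_side_two_mod_six : ∀ n : ℕ, n % 6 = 2 → 14 ≤ n → ∀ f g : (Fin n → Bool) → Bool,
    IsDegLeFun 3 f → IsDegLeFun 3 g → 1 - (1 / 2 : ℝ) ^ (n / 3) ≤ forrelation f g → forrelation f g ≠ 1 →
    (∃ u' : (Fin n → Bool) → ℤ, (∀ x, W (fun y => signOf (g y)) x = (2 : ℝ) ^ (n / 3 + 2) * (u' x : ℝ)) ∧
      2 ^ (n - 2) ≤ #(univ.filter fun x : Fin n → Bool => Odd (u' x)) ∧ #(univ.filter fun x : Fin n → Bool => Odd (u' x)) < 2 ^ (n - 1)) ∨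
    (∃ u : (Fin n → Bool) → ℤ, (∀ x, W (fun y => signOf (g y)) x = (2 : ℝ) ^ (n / 3 + 1) * (u x : ℝ)) ∧ (∀ x, Odd (u x)) ∧
      (#(univ.filter fun a : Fin n → Bool => ∀ b, (decide (Odd (u zeroVec / 2)) ^^ decide (Odd (u a / 2)) ^^
          decide (Odd (u b / 2)) ^^ decide (Odd (u (bxor a b) / 2))) = false) < 2 ^ (n - 2) ∨
        (2 ^ (n - 2) ≤ #(univ.filter fun a : Fin n → Bool => ∀ b, (decide (Odd (u zeroVec / 2)) ^^ decide (Odd (u a / 2)) ^^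
            decide (Odd (u b / 2)) ^^ decide (Odd (u (bxor a b) / 2))) = false) ∧
          ∀ x, (8 : ℤ) ∣ u x - 2 ^ (n / 6) - 1 ∨ (8 : ℤ) ∣ u x - 2 ^ (n / 6) + 1))) := by
  intro n hn h14 f g hf hg hΦ hne
  obtain ⟨r, rfl⟩ : ∃ r, n = (3 * r + 1) + (3 * r + 1) := ⟨n / 6, by omega⟩
  have e1 : ((3 * r + 1) + (3 * r + 1)) / 3 = 2 * r := by omega
  have e2 : ((3 * r + 1) + (3 * r + 1)) / 6 = r := by omega
  have e3 : (3 * r + 1) + (3 * r + 1) - 2 = 6 * r := by omega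
  have e4 : (3 * r + 1) + (3 * r + 1) - 1 = 6 * r + 1 := by omega
  rw [e1] at hΦ
  rw [e1, e2, e3, e4]
  have hr2 : 2 ≤ r := by omega
  rcases Nat.eq_or_lt_of_le hr2 with rfl | hr3
  · rcases fo_side_structure f g hf hg (by norm_num at hΦ; exact hΦ) hne with ⟨u', hu', h1, h2⟩ | ⟨u, hu, hou, hgu⟩
    · exact Or.inl ⟨u', hu', Eq.trans_le (by norm_num) h1, h2.trans_eq (by norm_num)⟩
    · refine Or.inr ⟨u, hu, hou, ?_⟩
      rcases hgu with h | hA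
      · exact Or.inl (h.trans_eq (by norm_num))
      · have hA' : ∀ x, (8 : ℤ) ∣ u x - 2 ^ 2 - 1 ∨ (8 : ℤ) ∣ u x - 2 ^ 2 + 1 := fun x => (fo_cheap_iff (u x) (hou x)).1 (hA x)
        exact Or.inr ⟨tm2_cheap_rank_le_two 2 le_rfl g u hg hu hA', hA'⟩
  · rcases tm2_side_structure r hr3 f g hf hg hΦ hne with h | ⟨u, hu, hou, hgu⟩
    · exact Or.inl h
    · refine Or.inr ⟨u, hu, hou, ?_⟩
      rcases hgu with h | hA
      · exact Or.inl h
      · have hA' : ∀ x, (8 : ℤ) ∣ u x - 2 ^ r - 1 ∨ (8 : ℤ) ∣ u x - 2 ^ r + 1 :=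
          fun x => (tm2_cheap_iff r hr3 (u x) (hou x)).1 (hA x)
        exact Or.inr ⟨tm2_cheap_rank_le_two r hr2 g u hg hu hA', hA'⟩

/-- **Structure at the second boundary, uniformly on `n ≡ 2 (mod 6)`, `n ≥ 14`.**  If cubic `f, g : 𝔽₂ⁿ → 𝔽₂` satisfy
`1 − 2^{−⌊n/3⌋} ≤ Φ(f,g)` and `Φ(f,g) ≠ 1` then:  `g` is at level `⌊n/3⌋+2` with `2^{n−2} ≤ #{W_g/2^{⌊n/3⌋+2} odd} < 2^{n−1}`;  or `f` is;  or both
spectra are of type O (`W = 2^{⌊n/3⌋+1}u`, `u` odd everywhere) and on each side the radical of the first digit `[⌊u/2⌋ odd]` has fewer than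
`2^{n−2}` elements (rank `d₁ ≥ 4`), or it has `≥ 2^{n−2}` elements (rank `≤ 2`) AND every point is cheap: `u ≡ 2^{n/6} ± 1 (mod 8)`
(`tm2_cheap_rank_le_two`).  The certified residual list — NOT a proof of
`θ_n < 1 − 2^{−⌊n/3⌋}`, NOT summit progress. [this work] -/
theorem second_boundary_structure_two_mod_six : ∀ n : ℕ, n % 6 = 2 → 14 ≤ n → ∀ f g : (Fin n → Bool) → Bool,
    IsDegLeFun 3 f → IsDegLeFun 3 g → 1 - (1 / 2 : ℝ) ^ (n / 3) ≤ forrelation f g → forrelation f g ≠ 1 →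
    (∃ u' : (Fin n → Bool) → ℤ, (∀ x, W (fun y => signOf (g y)) x = (2 : ℝ) ^ (n / 3 + 2) * (u' x : ℝ)) ∧
      2 ^ (n - 2) ≤ #(univ.filter fun x : Fin n → Bool => Odd (u' x)) ∧ #(univ.filter fun x : Fin n → Bool => Odd (u' x)) < 2 ^ (n - 1)) ∨
    (∃ v' : (Fin n → Bool) → ℤ, (∀ y, W (fun x => signOf (f x)) y = (2 : ℝ) ^ (n / 3 + 2) * (v' y : ℝ)) ∧
      2 ^ (n - 2) ≤ #(univ.filter fun y : Fin n → Bool => Odd (v' y)) ∧ #(univ.filter fun y : Fin n → Bool => Odd (v' y)) < 2 ^ (n - 1)) ∨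
    (∃ u v : (Fin n → Bool) → ℤ, (∀ x, W (fun y => signOf (g y)) x = (2 : ℝ) ^ (n / 3 + 1) * (u x : ℝ)) ∧
      (∀ y, W (fun x => signOf (f x)) y = (2 : ℝ) ^ (n / 3 + 1) * (v y : ℝ)) ∧ (∀ x, Odd (u x)) ∧ (∀ y, Odd (v y)) ∧
      (#(univ.filter fun a : Fin n → Bool => ∀ b, (decide (Odd (u zeroVec / 2)) ^^ decide (Odd (u a / 2)) ^^
          decide (Odd (u b / 2)) ^^ decide (Odd (u (bxor a b) / 2))) = false) < 2 ^ (n - 2) ∨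
        (2 ^ (n - 2) ≤ #(univ.filter fun a : Fin n → Bool => ∀ b, (decide (Odd (u zeroVec / 2)) ^^ decide (Odd (u a / 2)) ^^
            decide (Odd (u b / 2)) ^^ decide (Odd (u (bxor a b) / 2))) = false) ∧
          ∀ x, (8 : ℤ) ∣ u x - 2 ^ (n / 6) - 1 ∨ (8 : ℤ) ∣ u x - 2 ^ (n / 6) + 1)) ∧
      (#(univ.filter fun a : Fin n → Bool => ∀ b, (decide (Odd (v zeroVec / 2)) ^^ decide (Odd (v a / 2)) ^^
          decide (Odd (v b / 2)) ^^ decide (Odd (v (bxor a b) / 2))) = false) < 2 ^ (n - 2) ∨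
        (2 ^ (n - 2) ≤ #(univ.filter fun a : Fin n → Bool => ∀ b, (decide (Odd (v zeroVec / 2)) ^^ decide (Odd (v a / 2)) ^^
            decide (Odd (v b / 2)) ^^ decide (Odd (v (bxor a b) / 2))) = false) ∧
          ∀ y, (8 : ℤ) ∣ v y - 2 ^ (n / 6) - 1 ∨ (8 : ℤ) ∣ v y - 2 ^ (n / 6) + 1))) := by
  intro n hn h14 f g hf hg hΦ hne
  obtain ⟨r, rfl⟩ : ∃ r, n = (3 * r + 1) + (3 * r + 1) := ⟨n / 6, by omega⟩
  have e1 : ((3 * r + 1) + (3 * r + 1)) / 3 = 2 * r := by omega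
  have e2 : ((3 * r + 1) + (3 * r + 1)) / 6 = r := by omega
  have e3 : (3 * r + 1) + (3 * r + 1) - 2 = 6 * r := by omega
  have e4 : (3 * r + 1) + (3 * r + 1) - 1 = 6 * r + 1 := by omega
  rw [e1] at hΦ
  rw [e1, e2, e3, e4]
  have hr2 : 2 ≤ r := by omega
  rcases Nat.eq_or_lt_of_le hr2 with rfl | hr3
  · -- `n = 14`
    rcases fo_second_structure_sharp f g hf hg (by norm_num at hΦ; exact hΦ) hne with
      ⟨u', hu', h1, h2⟩ | ⟨v', hv', h1, h2⟩ | ⟨u, v, hu, hv, hou, hov, hgu, hfv⟩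
    · exact Or.inl ⟨u', hu', Eq.trans_le (by norm_num) h1, h2.trans_eq (by norm_num)⟩
    · exact Or.inr (Or.inl ⟨v', hv', Eq.trans_le (by norm_num) h1, h2.trans_eq (by norm_num)⟩)
    · refine Or.inr (Or.inr ⟨u, v, hu, hv, hou, hov, ?_, ?_⟩)
      · rcases hgu with h | hA
        · exact Or.inl (h.trans_eq (by norm_num))
        · have hA' : ∀ x, (8 : ℤ) ∣ u x - 2 ^ 2 - 1 ∨ (8 : ℤ) ∣ u x - 2 ^ 2 + 1 := fun x => (fo_cheap_iff (u x) (hou x)).1 (hA x)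
          exact Or.inr ⟨tm2_cheap_rank_le_two 2 le_rfl g u hg hu hA', hA'⟩
      · rcases hfv with h | hA
        · exact Or.inl (h.trans_eq (by norm_num))
        · have hA' : ∀ y, (8 : ℤ) ∣ v y - 2 ^ 2 - 1 ∨ (8 : ℤ) ∣ v y - 2 ^ 2 + 1 := fun y => (fo_cheap_iff (v y) (hov y)).1 (hA y)
          exact Or.inr ⟨tm2_cheap_rank_le_two 2 le_rfl f v hf hv hA', hA'⟩
  · -- `n ≥ 20`
    rcases tm2_second_structure r hr3 f g hf hg hΦ hne with h | h | ⟨u, v, hu, hv, hou, hov, hgu, hfv⟩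
    · exact Or.inl h
    · exact Or.inr (Or.inl h)
    · refine Or.inr (Or.inr ⟨u, v, hu, hv, hou, hov, ?_, ?_⟩)
      · rcases hgu with h | hA
        · exact Or.inl h
        · have hA' : ∀ x, (8 : ℤ) ∣ u x - 2 ^ r - 1 ∨ (8 : ℤ) ∣ u x - 2 ^ r + 1 :=
            fun x => (tm2_cheap_iff r hr3 (u x) (hou x)).1 (hA x)
          exact Or.inr ⟨tm2_cheap_rank_le_two r hr2 g u hg hu hA', hA'⟩
      · rcases hfv with h | hA
        · exact Or.inl h
        · have hA' : ∀ y, (8 : ℤ) ∣ v y - 2 ^ r - 1 ∨ (8 : ℤ) ∣ v y - 2 ^ r + 1 :=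
            fun y => (tm2_cheap_iff r hr3 (v y) (hov y)).1 (hA y)
          exact Or.inr ⟨tm2_cheap_rank_le_two r hr2 f v hf hv hA', hA'⟩

end Summit.QuantumAdvantage.QuantumAdvantage.Theorems.CubicForrelation.NearExactIsExact

end
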